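import Literature.Computability.Complexity.ModularRoundsFP
import Literature.Computability.Complexity.CodeFPFinite
import HarnessLib

/-!
# The modular diagonalisation solver in polynomial time on codes

Topic `Literature/Computability/Complexity`; the machine side of the pivot search, the peeling
loop and the solver `ModDiag.solve` of `Literature/LinearAlgebra/Matrix/ModularDiagonalSolver.lean`
(sequel of `ModularRoundsFP.lean`):

* `firstNZ_codeFP` (a scan with state `(found?, index)`), `splitPivot_codeFP` (a scan with state
  `(found?, other rows)`; `List.take c` of a row by the unary `min c |row|`);
* **`peelStep_codeFP`** (context `(N, budgetF, budgetR)`, state `((c, M), ok)`; the gcd test by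
  `gcdSucc_codeFP`);
* **`solve_codeFP`**: `(((N, budgetF, budgetR), state), budgetP) ↦ solve N |budgetF| |budgetR| |budgetP| state`.

The state of the peeling loop stays small (`c` only decreases; the rows are tails of rows produced
by the rounds from rows of the input), whence the polynomial bound of `CodeFP.foldl`.

## References

* S. Arora, B. Barak, *Computational Complexity: A Modern Approach*, CUP 2009, §1.3
  [AroraBarak2009].
* A. Schrijver, *Theory of Linear and Integer Programming*, Wiley 1986, §5.3 [Schrijver1986].
-/

namespace Literature.Computability.Complexity

namespace ModDiagFP

open CodeFP Polynomial _root_.Computability Literature.LinearAlgebra.Matrix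
  Literature.LinearAlgebra.Matrix.ModDiag

/-- Rows of naturals: raw lists of binary numerals. -/
local notation "rowE" => rawE natE

/-- Row lists. -/
local notation "matE" => rawE (rawE natE)

/-- Budgets: raw lists of units. -/
local notation "budE" => rawE unitE

/-! ### The index of the first non-zero entry -/

/-- The scan computing `firstNZ`: state `(found?, current index)`. [folklore] -/
def fnzStep (a : ℕ) (st : Option ℕ × ℕ) : Option ℕ × ℕ :=
  (if st.1.isSome then st.1 else if a = 0 then none else some st.2, st.2 + 1)

/-- Once found, the scan only counts. [folklore] -/
theorem foldl_fnzStep_some (l : List ℕ) (j i : ℕ) : l.foldl (fun st a => fnzStep a st) (some j, i) = (some j, i + l.length) := by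
  induction l generalizing i with
  | nil => rfl
  | cons a l ih =>
    rw [List.foldl_cons, show fnzStep a (some j, i) = (some j, i + 1) from rfl, ih, List.length_cons]
    congr 1
    omega

/-- **Semantics of the scan**: from `(none, i)` it ends with `firstNZ` shifted by `i`. [folklore] -/
theorem foldl_fnzStep_none (l : List ℕ) (i : ℕ) :
    l.foldl (fun st a => fnzStep a st) (none, i) = ((firstNZ l).map (· + i), i + l.length) := by
  induction l generalizing i with
  | nil => rfl
  | cons a l ih =>
    rw [List.foldl_cons, firstNZ]
    by_cases ha : a = 0
    · rw [show fnzStep a (none, i) = (none, i + 1) by simp [fnzStep, ha], ih, if_pos ha, List.length_cons]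
      cases firstNZ l with
      | none => exact Prod.ext rfl (by change i + 1 + l.length = i + (l.length + 1); omega)
      | some j =>
        refine Prod.ext ?_ (by change i + 1 + l.length = i + (l.length + 1); omega)
        change some (j + (i + 1)) = some (Nat.succ j + i)
        congr 1; omega
    · rw [show fnzStep a (none, i) = (some i, i + 1) by simp [fnzStep, ha], foldl_fnzStep_some, if_neg ha, List.length_cons]
      refine Prod.ext ?_ (by change i + 1 + l.length = i + (l.length + 1); omega)
      change some i = some (0 + i)
      rw [Nat.zero_add]

/-- **`firstNZ` on codes.** [cite: AroraBarak2009, §1.3] -/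
theorem firstNZ_codeFP : CodeFP rowE (optE natE) firstNZ := by
  let tE := pairE natE (pairE (optE natE) natE)
  have pa : CodeFP tE natE (fun t => t.1) := fst _ _
  have pf : CodeFP tE (optE natE) (fun t => t.2.1) := (snd _ _).fst'
  have pi : CodeFP tE natE (fun t => t.2.2) := (snd _ _).snd'
  have hin : CodeFP tE (optE natE) (fun t => if t.1 = 0 then none else some t.2.2) :=
    ((natEq.comp (pa.pair (const _ 0))).ite (const _ none) ((optSome natE).comp pi)).congr fun t => by
      simp only [decide_eq_true_eq]
  have hfound : CodeFP tE (optE natE) (fun t => if t.2.1.isSome then t.2.1 else if t.1 = 0 then none else some t.2.2) :=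
    ((optIsSome natE).comp pf).ite pf hin
  have hstep : CodeFP tE (pairE (optE natE) natE) (fun t => fnzStep t.1 t.2) :=
    (hfound.pair (natAdd.comp (pi.pair (const _ 1)))).congr fun _ => rfl
  have h := foldl₀ (eα := natE) (eβ := pairE (optE natE) natE) (step := fun a st => fnzStep a st) (b₀ := (none, 0)) hstep
    (5 * X + 6) (fun l₁ l₂ => by
      rw [foldl_fnzStep_none, Nat.zero_add]
      have hl : l₁.length ≤ (rawE natE (l₁ ++ l₂)).length := le_trans (by simp) (length_le_length_rawE natE (l₁ ++ l₂))
      set W := (rawE natE (l₁ ++ l₂)).length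
      have hi : (natE l₁.length).length ≤ W := (length_natE_le _).trans hl
      have hf : (optE natE ((firstNZ l₁).map (· + 0))).length ≤ 2 * W + 2 := by
        cases h : firstNZ l₁ with
        | none => simp
        | some j =>
          obtain ⟨hj, -⟩ := firstNZ_eq_some h
          have : (natE j).length ≤ W := (length_natE_le _).trans (by omega)
          simp only [Option.map_some, Nat.add_zero, optE_some, length_boolPair, List.length_nil]
          omega
      rw [pairE_apply, length_boolPair]
      simp only [eval_add, eval_mul, eval_ofNat, eval_X]
      omega)
  exact h.fst'.congr fun l => by rw [foldl_fnzStep_none]; simp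

/-! ### The pivot search -/

/-- The scan computing `splitPivot c`: state `(found? (row, index), other rows)`. [folklore] -/
def spStep (c : ℕ) (r : List ℕ) (st : Option (List ℕ × ℕ) × List (List ℕ)) : Option (List ℕ × ℕ) × List (List ℕ) :=
  if st.1.isSome then (st.1, st.2 ++ [r]) else
    match firstNZ (r.take c) with
    | some j => (some (r, j), st.2)
    | none => (none, st.2 ++ [r])

/-- The verdict of the scan. [folklore] -/
def spOut (st : Option (List ℕ × ℕ) × List (List ℕ)) : Option (List ℕ × ℕ × List (List ℕ)) :=
  st.1.map fun p => (p.1, p.2, st.2)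

/-- Once found, the scan only collects the other rows. [folklore] -/
theorem foldl_spStep_some (c : ℕ) (M : List (List ℕ)) (p : List ℕ × ℕ) (acc : List (List ℕ)) :
    M.foldl (fun st r => spStep c r st) (some p, acc) = (some p, acc ++ M) := by
  induction M generalizing acc with
  | nil => simp
  | cons r M ih => rw [List.foldl_cons, show spStep c r (some p, acc) = (some p, acc ++ [r]) from rfl, ih]; simp

/-- **Semantics of the scan.** [folklore] -/
theorem foldl_spStep_none (c : ℕ) (M : List (List ℕ)) (acc : List (List ℕ)) :
    M.foldl (fun st r => spStep c r st) (none, acc) =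
      match splitPivot c M with
      | none => (none, acc ++ M)
      | some (r, j, M') => (some (r, j), acc ++ M') := by
  induction M generalizing acc with
  | nil => simp [splitPivot]
  | cons r M ih =>
    rw [List.foldl_cons, splitPivot]
    cases hf : firstNZ (r.take c) with
    | some j =>
      rw [show spStep c r (none, acc) = (some (r, j), acc) by simp [spStep, hf], foldl_spStep_some]
    | none =>
      rw [show spStep c r (none, acc) = (none, acc ++ [r]) by simp [spStep, hf], ih]
      cases splitPivot c M with
      | none => simp
      | some p => obtain ⟨r', j', M'⟩ := p; simp

/-- `splitPivot` is the verdict of the scan. [folklore] -/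
theorem splitPivot_eq_spOut (c : ℕ) (M : List (List ℕ)) :
    splitPivot c M = spOut (M.foldl (fun st r => spStep c r st) (none, [])) := by
  rw [foldl_spStep_none]
  cases splitPivot c M with
  | none => rfl
  | some p => obtain ⟨r, j, M'⟩ := p; rfl

/-- The other rows of a successful pivot search are a sublist, the pivot row is a member.
[folklore] -/
theorem splitPivot_sublist {c : ℕ} {M : List (List ℕ)} {r : List ℕ} {j : ℕ} {M' : List (List ℕ)}
    (h : splitPivot c M = some (r, j, M')) : M'.Sublist M ∧ r ∈ M := by
  induction M generalizing M' with
  | nil => simp [splitPivot] at h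
  | cons r₀ M ih =>
    unfold splitPivot at h
    cases hf : firstNZ (r₀.take c) with
    | some j₀ =>
      rw [hf] at h
      simp only [Option.some.injEq, Prod.mk.injEq] at h
      obtain ⟨rfl, rfl, rfl⟩ := h
      exact ⟨List.sublist_cons_self _ _, List.mem_cons_self⟩
    | none =>
      rw [hf] at h
      cases hs : splitPivot c M with
      | none => rw [hs] at h; simp at h
      | some p =>
        rw [hs] at h
        obtain ⟨r₁, j₁, M₁⟩ := p
        simp only [Option.map_some, Option.some.injEq, Prod.mk.injEq] at h
        obtain ⟨rfl, rfl, rfl⟩ := h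
        obtain ⟨h1, h2⟩ := ih hs
        exact ⟨List.Sublist.cons_cons r₀ h1, List.mem_cons_of_mem r₀ h2⟩

/-- **`splitPivot` on codes**: `(c, M) ↦ splitPivot c M`. [cite: AroraBarak2009, §1.3] -/
theorem splitPivot_codeFP : CodeFP (pairE natE matE) (optE (pairE rowE (pairE natE matE))) (fun t => splitPivot t.1 t.2) := by
  let fE := optE (pairE rowE natE)
  let stE := pairE fE matE
  let tE := pairE natE (pairE rowE stE)
  have pc : CodeFP tE natE (fun t => t.1) := fst _ _
  have pr : CodeFP tE rowE (fun t => t.2.1) := (snd _ _).fst'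
  have pf : CodeFP tE fE (fun t => t.2.2.1) := (snd _ _).snd'.fst'
  have po : CodeFP tE matE (fun t => t.2.2.2) := (snd _ _).snd'.snd'
  -- `r.take c` through the unary `min c |r|`
  have htake : CodeFP tE rowE (fun t => t.2.1.take t.1) :=
    ((rawTakeUn natE).comp ((unOfNatMin.comp (((ulength natE).comp pr).pair pc)).pair pr)).congr fun t => by
      simp only; rw [← List.take_eq_take_min]
  have hfnz : CodeFP tE (optE natE) (fun t => firstNZ (t.2.1.take t.1)) := firstNZ_codeFP.comp htake
  have happ : CodeFP tE matE (fun t => t.2.2.2 ++ [t.2.1]) := (rawAppend (rawE natE)).comp (po.pair ((rawSingleton (rawE natE)).comp pr))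
  -- the `match` on `firstNZ (r.take c)` as an option case analysis with context `t`
  have hmatch : CodeFP tE stE (fun t => match firstNZ (t.2.1.take t.1) with
      | some j => (some (t.2.1, j), t.2.2.2) | none => (none, t.2.2.2 ++ [t.2.1])) := by
    have h := optCases (σ := ℕ × (List ℕ × (Option (List ℕ × ℕ) × List (List ℕ)))) (α := ℕ) (eσ := tE) (eα := natE) (eδ := stE)
      (k := fun t o => match o with | some j => (some (t.2.1, j), t.2.2.2) | none => (none, t.2.2.2 ++ [t.2.1]))
      ((const _ none).pair happ)
      (((optSome (pairE rowE natE)).comp ((pr.comp (fst _ _)).pair (snd _ _))).pair (po.comp (fst _ _)))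
      (fun _ => rfl) (fun _ _ => rfl)
    exact (h.comp ((CodeFP.id _).pair hfnz)).congr fun t => rfl
  have hstep : CodeFP tE stE (fun t => spStep t.1 t.2.1 t.2.2) :=
    ((((optIsSome _).comp pf).ite (pf.pair happ) hmatch).congr fun t => by
      unfold spStep; split_ifs <;> rfl)
  have hinit : CodeFP natE stE (fun _ => ((none : Option (List ℕ × ℕ)), ([] : List (List ℕ)))) := const _ _
  have hfold := foldl (σ := ℕ) (α := List ℕ) (β := Option (List ℕ × ℕ) × List (List ℕ)) (eσ := natE) (eα := rowE) (eβ := stE)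
    (step := fun c r st => spStep c r st) (init := fun _ => (none, [])) hstep hinit (13 * X + 14) (fun c l₁ l₂ => by
      rw [foldl_spStep_none, List.nil_append]
      set W := (pairE natE matE (c, l₁ ++ l₂)).length with hW
      have hl : (rawE (rawE natE) (l₁ ++ l₂)).length ≤ W := by simp only [hW, pairE_apply, length_boolPair]; omega
      have hl₁ : (rawE (rawE natE) l₁).length ≤ W :=
        (length_rawE_le_of_sublist (rawE natE) (List.sublist_append_left l₁ l₂)).trans hl
      cases hs : splitPivot c l₁ with
      | none =>
        simp only [stE, fE, pairE_apply, optE_none, length_boolPair, List.length_nil, eval_add, eval_mul, eval_ofNat, eval_X]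
        omega
      | some p =>
        obtain ⟨r, j, M'⟩ := p
        simp only [List.nil_append]
        obtain ⟨hsub, hr⟩ := splitPivot_sublist hs
        obtain ⟨-, -, -, hjl, -⟩ := splitPivot_eq_some hs
        have hrW : 2 * (rawE natE r).length + 2 ≤ W := (length_item_le_length_rawE (rawE natE) hr).trans hl₁
        have hjW : (natE j).length ≤ W := (length_natE_le j).trans (by have := length_le_length_rawE natE r; omega)
        have hM' : (rawE (rawE natE) M').length ≤ W := (length_rawE_le_of_sublist (rawE natE) hsub).trans hl₁
        simp only [stE, fE, pairE_apply, optE_some, length_boolPair, List.length_nil, eval_add, eval_mul, eval_ofNat, eval_X]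
        omega)
  -- the verdict
  have hout : CodeFP stE (optE (pairE rowE (pairE natE matE))) spOut :=
    (optMap (σ := List (List ℕ)) (eσ := matE) (eα := pairE rowE natE) (eβ := pairE rowE (pairE natE matE))
      (g := fun q => (q.2.1, q.2.2, q.1)) ((snd _ _).fst'.pair ((snd _ _).snd'.pair (fst _ _)))).comp ((snd _ _).pair (fst _ _))
  exact (hout.comp hfold).congr fun t => (splitPivot_eq_spOut t.1 t.2).symm

/-! ### The peeling step -/

/-- The context of the solver: `(N, budgetF, budgetR)`. -/
local notation "ctxE" => pairE natE (pairE budE budE)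

/-- The state of the solver: `((c, M), ok)`. -/
local notation "stE" => pairE (pairE natE matE) bitE

/-- The result of a peeling step without pivot. [folklore] -/
def peelNone (c : ℕ) (M : List (List ℕ)) (ok : Bool) : (ℕ × List (List ℕ)) × Bool :=
  ((c, []), ok && M.all fun r => decide (r.getD c 0 = 0))

/-- The row list after the rounds, for the pivot `(r, j, M')`. [folklore] -/
def peelMat (N F c R : ℕ) (r : List ℕ) (j : ℕ) (M' : List (List ℕ)) : List (List ℕ) :=
  rounds N F c R ((r :: M').map (swapCols j))

/-- The recorded solvability condition `gcd (p, N+1) ∣ b₀` of a cleared row list. [folklore] -/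
def peelCond (N c : ℕ) (M₂ : List (List ℕ)) : Bool :=
  decide ((M₂.headD []).getD c 0 % Nat.gcd ((M₂.headD []).getD 0 0) (N + 1) = 0)

/-- The result of a peeling step with pivot `(r, j, M')`. [folklore] -/
def peelSome (N F R c : ℕ) (ok : Bool) (r : List ℕ) (j : ℕ) (M' : List (List ℕ)) : (ℕ × List (List ℕ)) × Bool :=
  ((c - 1, ((peelMat N F c R r j M').tail).map List.tail), ok && peelCond N c (peelMat N F c R r j M'))

/-- `peelStep` by cases on the pivot search. [folklore] -/
theorem peelStep_eq (N F R : ℕ) (st : (ℕ × List (List ℕ)) × Bool) :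
    peelStep N F R st = match splitPivot st.1.1 st.1.2 with
      | none => peelNone st.1.1 st.1.2 st.2
      | some (r, j, M') => peelSome N F R st.1.1 st.2 r j M' := by
  unfold peelStep
  cases splitPivot st.1.1 st.1.2 with
  | none => rfl
  | some p => obtain ⟨r, j, M'⟩ := p; rfl

/-- A state is `W`-SMALL: the numeral `c` has at most `W` bits and the matrix is `W`-small.
[folklore] -/
def StSmall (W : ℕ) (st : (ℕ × List (List ℕ)) × Bool) : Prop := (natE st.1.1).length ≤ W ∧ MatSmall W st.1.2

/-- A sublist of a small row list with small members is small. [folklore] -/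
theorem matSmall_of_sublist {W : ℕ} {M M' : List (List ℕ)} (h : MatSmall W M) (hs : M'.Sublist M) : MatSmall W M' :=
  ⟨hs.length_le.trans h.1, fun r hr => h.2 r (hs.subset hr)⟩

/-- Tails of small rows are small. [folklore] -/
theorem rowSmall_tail {W : ℕ} {r : List ℕ} (h : RowSmall W r) : RowSmall W r.tail :=
  ⟨(by rw [List.length_tail]; exact (Nat.sub_le _ _).trans h.1), fun e he => h.2 e (List.mem_of_mem_tail he)⟩

/-- **`peelStep` keeps a small state small** (its rows are tails of rows produced by the rounds from
column-swapped input rows). [folklore] -/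
theorem stSmall_peelStep {W N : ℕ} (hN : (natE N).length ≤ W) (F R : ℕ) {st : (ℕ × List (List ℕ)) × Bool} (h : StSmall W st) :
    StSmall W (peelStep N F R st) := by
  obtain ⟨⟨c, M⟩, ok⟩ := st
  obtain ⟨hc, hM⟩ := h
  rw [peelStep_eq]
  dsimp only
  cases hs : splitPivot c M with
  | none => exact ⟨hc, by simp [MatSmall, peelNone]⟩
  | some p =>
    obtain ⟨r, j, M'⟩ := p
    dsimp only
    obtain ⟨hsub, hr⟩ := splitPivot_sublist hs
    refine ⟨(length_natE_mono (Nat.sub_le c 1)).trans hc, ?_⟩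
    have h0 : MatSmall W (r :: M') :=
      ⟨by have := (splitPivot_eq_some hs).2.1; rw [List.length_cons, this]; exact hM.1,
        fun x hx => by rcases List.mem_cons.1 hx with rfl | hx; exacts [hM.2 _ hr, hM.2 _ (hsub.subset hx)]⟩
    have h1 : MatSmall W ((r :: M').map (swapCols j)) :=
      ⟨by simpa using h0.1, fun x hx => by obtain ⟨x', hx', rfl⟩ := List.mem_map.1 hx; exact rowSmall_swapCols (h0.2 x' hx')⟩
    have h2 : MatSmall W (peelMat N F c R r j M') := matSmall_rounds hN F c R h1
    have h3 : MatSmall W (peelMat N F c R r j M').tail := matSmall_of_sublist h2 (List.tail_sublist _)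
    exact ⟨by simpa [peelSome] using h3.1, fun x hx => by
      simp only [peelSome] at hx
      obtain ⟨x', hx', rfl⟩ := List.mem_map.1 hx; exact rowSmall_tail (h3.2 x' hx')⟩

/-- The code of a small state. [folklore] -/
theorem length_stE_le {W : ℕ} {st : (ℕ × List (List ℕ)) × Bool} (h : StSmall W st) :
    (pairE (pairE natE matE) bitE st).length ≤ 2 * (2 * W + 2 + W * (2 * (W * (2 * W + 2)) + 2)) + 2 + 1 := by
  obtain ⟨⟨c, M⟩, ok⟩ := st
  obtain ⟨hc, hM⟩ := h
  have b2 := length_rawE_le_of_matSmall hM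
  have b3 : (bitE ok).length = 1 := rfl
  simp only [pairE_apply, length_boolPair, b3]
  dsimp only at hc b2
  omega

/-- The item context of the pivot case: `(((N, budgetF, budgetR), (c, M), ok), r, j, M')`. -/
local notation "pivE" => pairE (pairE ctxE stE) (pairE rowE (pairE natE matE))

/-- **The row list after the rounds on codes**, in the pivot context. [cite: AroraBarak2009, §1.3] -/
theorem peelMat_codeFP : CodeFP pivE matE (fun q => peelMat q.1.1.1 q.1.1.2.1.length q.1.2.1.1 q.1.1.2.2.length q.2.1 q.2.2.1 q.2.2.2) := by
  have qN : CodeFP pivE natE (fun q => q.1.1.1) := (fst _ _).fst'.fst'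
  have qF : CodeFP pivE budE (fun q => q.1.1.2.1) := (fst _ _).fst'.snd'.fst'
  have qR : CodeFP pivE budE (fun q => q.1.1.2.2) := (fst _ _).fst'.snd'.snd'
  have qc : CodeFP pivE natE (fun q => q.1.2.1.1) := (fst _ _).snd'.fst'.fst'
  have qr : CodeFP pivE rowE (fun q => q.2.1) := (snd _ _).fst'
  have qj : CodeFP pivE natE (fun q => q.2.2.1) := (snd _ _).snd'.fst'
  have qM' : CodeFP pivE matE (fun q => q.2.2.2) := (snd _ _).snd'.snd'
  have hM₁ : CodeFP pivE matE (fun q => (q.2.1 :: q.2.2.2).map (swapCols q.2.2.1)) :=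
    ((map (σ := ℕ) (eσ := natE) (eα := rowE) (g := fun t => swapCols t.1 t.2) swapCols_codeFP).comp
      (qj.pair ((rawCons (rawE natE)).comp (qr.pair qM')))).congr fun _ => rfl
  exact (rounds_codeFP.comp (((qN.pair (qF.pair qc)).pair hM₁).pair qR)).congr fun _ => rfl

/-- **The recorded condition on codes**: `((N, c), M₂) ↦ peelCond N c M₂`. [cite: AroraBarak2009, §1.3] -/
theorem peelCond_codeFP : CodeFP (pairE (pairE natE natE) matE) bitE (fun t => peelCond t.1.1 t.1.2 t.2) := by
  let tE := pairE (pairE natE natE) matE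
  have get : CodeFP (pairE rowE natE) natE (fun p => p.1.getD p.2 0) := rawGetD natE (d := 0) natE_zero
  have htop : CodeFP tE rowE (fun t => t.2.headD []) := (rawHeadD (rawE natE) (d := []) rfl).comp (snd _ _)
  have hb : CodeFP tE natE (fun t => (t.2.headD []).getD t.1.2 0) := get.comp (htop.pair (fst _ _).snd')
  have hp : CodeFP tE natE (fun t => (t.2.headD []).getD 0 0) := get.comp (htop.pair (const _ 0))
  have hg : CodeFP tE natE (fun t => Nat.gcd ((t.2.headD []).getD 0 0) (t.1.1 + 1)) := gcdSucc_codeFP.comp (hp.pair (fst _ _).fst')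
  exact (natEq.comp ((natMod.comp (hb.pair hg)).pair (const _ 0))).congr fun _ => rfl

/-- **The pivot case on codes.** [cite: AroraBarak2009, §1.3] -/
theorem peelSome_codeFP :
    CodeFP pivE stE (fun q => peelSome q.1.1.1 q.1.1.2.1.length q.1.1.2.2.length q.1.2.1.1 q.1.2.2 q.2.1 q.2.2.1 q.2.2.2) := by
  have qN : CodeFP pivE natE (fun q => q.1.1.1) := (fst _ _).fst'.fst'
  have qc : CodeFP pivE natE (fun q => q.1.2.1.1) := (fst _ _).snd'.fst'.fst'
  have qok : CodeFP pivE bitE (fun q => q.1.2.2) := (fst _ _).snd'.snd'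
  have hnewM : CodeFP pivE matE (fun q => ((peelMat q.1.1.1 q.1.1.2.1.length q.1.2.1.1 q.1.1.2.2.length q.2.1 q.2.2.1 q.2.2.2).tail).map
      List.tail) := (map₀ (rawTail natE)).comp ((rawTail (rawE natE)).comp peelMat_codeFP)
  have hcond : CodeFP pivE bitE (fun q => peelCond q.1.1.1 q.1.2.1.1 (peelMat q.1.1.1 q.1.1.2.1.length q.1.2.1.1 q.1.1.2.2.length
      q.2.1 q.2.2.1 q.2.2.2)) := peelCond_codeFP.comp ((qN.pair qc).pair peelMat_codeFP)
  exact (((natSub.comp (qc.pair (const _ 1))).pair hnewM).pair (qok.and hcond)).congr fun _ => rfl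

/-- **The no-pivot case on codes**: `((c, M), ok) ↦ peelNone c M ok`. [cite: AroraBarak2009, §1.3] -/
theorem peelNone_codeFP : CodeFP stE stE (fun st => peelNone st.1.1 st.1.2 st.2) := by
  have get : CodeFP (pairE rowE natE) natE (fun p => p.1.getD p.2 0) := rawGetD natE (d := 0) natE_zero
  have pc : CodeFP stE natE (fun st => st.1.1) := (fst _ _).fst'
  have pM : CodeFP stE matE (fun st => st.1.2) := (fst _ _).snd'
  have hall : CodeFP stE bitE (fun st => st.1.2.all fun r => decide (r.getD st.1.1 0 = 0)) :=
    (all (σ := ℕ) (eσ := natE) (eα := rowE) (p := fun q => decide (q.2.getD q.1 0 = 0))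
      (natEq.comp ((get.comp ((snd _ _).pair (fst _ _))).pair (const _ 0)))).comp (pc.pair pM)
  exact ((pc.pair (const _ [])).pair ((snd _ _).and hall)).congr fun _ => rfl

/-- **`peelStep` on codes** (context `(N, budgetF, budgetR)`, state `((c, M), ok)`). [cite: AroraBarak2009, §1.3] -/
theorem peelStep_codeFP : CodeFP (pairE ctxE stE) stE (fun t => peelStep t.1.1 t.1.2.1.length t.1.2.2.length t.2) := by
  let tE := pairE ctxE stE
  have hsp : CodeFP tE (optE (pairE rowE (pairE natE matE))) (fun t => splitPivot t.2.1.1 t.2.1.2) :=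
    splitPivot_codeFP.comp ((snd _ _).fst'.fst'.pair (snd _ _).fst'.snd')
  have h := optCases (σ := (ℕ × (List Unit × List Unit)) × ((ℕ × List (List ℕ)) × Bool)) (α := List ℕ × (ℕ × List (List ℕ)))
    (eσ := tE) (eα := pairE rowE (pairE natE matE)) (eδ := stE)
    (k := fun t o => match o with
      | none => peelNone t.2.1.1 t.2.1.2 t.2.2
      | some (r, j, M') => peelSome t.1.1 t.1.2.1.length t.1.2.2.length t.2.1.1 t.2.2 r j M')
    (peelNone_codeFP.comp (snd _ _)) peelSome_codeFP (fun _ => rfl) (fun _ _ => rfl)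
  refine ((h.comp ((CodeFP.id _).pair hsp)).congr fun t => ?_)
  rw [peelStep_eq]
  rfl

/-! ### The solver -/

/-- The solver as a left fold over a budget. [folklore] -/
theorem solve_eq_foldl (N F R : ℕ) (l : List Unit) (st : (ℕ × List (List ℕ)) × Bool) :
    solve N F R l.length st = (l.foldl (fun st _ => peelStep N F R st) st).2 := by
  induction l generalizing st with
  | nil => rfl
  | cons u l ih => rw [List.length_cons, solve, List.foldl_cons, ih]

/-- The peeling fold keeps a small state small. [folklore] -/
theorem stSmall_foldl_peelStep {W N : ℕ} (hN : (natE N).length ≤ W) (F R : ℕ) (l : List Unit) {st : (ℕ × List (List ℕ)) × Bool}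
    (h : StSmall W st) : StSmall W (l.foldl (fun st _ => peelStep N F R st) st) := by
  induction l generalizing st with
  | nil => exact h
  | cons u l ih => rw [List.foldl_cons]; exact ih (stSmall_peelStep hN F R h)

/-- **The solver on codes**: `(((N, budgetF, budgetR), state), budgetP) ↦ solve N |budgetF| |budgetR| |budgetP| state`.
[cite: AroraBarak2009, §1.3 (polynomially bounded loops)] -/
theorem solve_codeFP :
    CodeFP (pairE (pairE ctxE stE) budE) bitE (fun p => solve p.1.1.1 p.1.1.2.1.length p.1.1.2.2.length p.2.length p.1.2) := by
  let cE := pairE ctxE stE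
  let tE := pairE cE (pairE unitE stE)
  have p1 : CodeFP tE ctxE (fun t => t.1.1) := (fst _ _).fst'
  have p2 : CodeFP tE stE (fun t => t.2.2) := (snd _ _).snd'
  -- (no type ascription here: checking it against the composed form is expensive for the unifier)
  have hstep := peelStep_codeFP.comp (p1.pair p2)
  have hinit : CodeFP cE stE (fun s => s.2) := snd _ _
  have hfold := foldl (σ := (ℕ × (List Unit × List Unit)) × ((ℕ × List (List ℕ)) × Bool)) (α := Unit) (β := (ℕ × List (List ℕ)) × Bool)
    (eσ := cE) (eα := unitE) (eβ := stE)
    (step := fun s _ st => peelStep s.1.1 s.1.2.1.length s.1.2.2.length st) (init := fun s => s.2) hstep hinit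
    (2 * (2 * X + 2 + X * (2 * (X * (2 * X + 2)) + 2)) + 2 + 1) (fun s l₁ l₂ => by
      obtain ⟨⟨N, bF, bR⟩, st⟩ := s
      set W := (pairE cE budE (((N, bF, bR), st), l₁ ++ l₂)).length with hW
      have hWN : (natE N).length ≤ W := by simp only [hW, cE, pairE_apply, length_boolPair]; omega
      have hc : (natE st.1.1).length ≤ W := by simp only [hW, cE, pairE_apply, length_boolPair]; omega
      have hM : (rawE (rawE natE) st.1.2).length ≤ W := by simp only [hW, cE, pairE_apply, length_boolPair]; omega
      have hsm := stSmall_foldl_peelStep hWN bF.length bR.length l₁ (st := st) ⟨hc, matSmall_of_length_le hM⟩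
      refine (length_stE_le hsm).trans (le_of_eq ?_)
      simp only [eval_add, eval_mul, eval_ofNat, eval_X, eval_one])
  exact (hfold.snd'.congr fun p => (solve_eq_foldl p.1.1.1 p.1.1.2.1.length p.1.1.2.2.length p.2 p.1.2).symm)

end ModDiagFP

end Literature.Computability.Complexity
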